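import Summits.QuantumFields.YangMills.Theorems.FluctuationComparisonRegPrIntLOrganTangentILawPathBlocksKnit
import Summits.QuantumFields.YangMills.Theorems.FluctuationComparisonRegPrIntLOrganTangentILawPathLawFactsOfReg
import HarnessLib

/-!
# Crux `FluctuationComparisonRegPrIntL` (stmt-QuantumFields-20520, rung R3), PATH-B organ, H-currency cone — (L51b) «THE (I-law) PATH BLOCKS KNIT, LAW FACTS STRUCK»:
# ✓p826244's two knits `ilawX_block_of_letters` ∕ `ilawV3_block_of_letters` RE-ISSUED with the KER′ «law facts» letter `hlaw` DELETED — in its place only binders the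
# consumer ✓`l1jSq∕jv3Sq_of_ilawAE` ALREADY carries (`hmF hΦm hJm hρm hρ′m` + the knit-side `hpath`); conclusions byte-identical

Cell `ym3-torus` (YM ladder rung R3 = continuum `SU(2)` Yang–Mills on the three-torus — a RUNG: NOT d = 4, NOT infinite volume, NOT a mass gap, NOT Clay).
Width seat `ym-ust-20520-w5` (gen 26), `--kind proof --supports stmt-QuantumFields-20520 --as helper`, count-neutral, DEFINITION-FREE, default heartbeats,
no registry ∕ binder ∕ `Lines/` edit.  Over ✓(L51a) `…OrganTangentILawPathLawFactsOfReg` (`lawFactsX_of_reg_at`, `lawFactsV3_of_reg`), ✓p823910 `ilawRegX∕V3_of_beta_of_incr`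
(REG′), ✓p825419 `kerXClause_of_covKernel_profiles` (the abstract KER′(X) door, here with the law∕score families FROZEN at the knit's `t` so that `hpath` stays
✓`l1jSq_of_ilawAE`'s per-`t` text), ✓p825783 `kerV3_organ`.

WHAT.  ★★★`ilawX_block_of_letters_frame` (per `t ∈ [0,1]`, as `hIlawX` is): binders = ✓`ilawX_block_of_letters`'s VERBATIM except `hlaw` ↦ (`hmF`, `hΦm hJm hρm hρ′m`, `hpath`
= ✓`l1jSq_of_ilawAE`'s text); conclusion = its conclusion VERBATIM (= the `hIlawX` binder text of ✓`l1jSq_of_ilawAE`).  ★★★`ilawV3_block_of_letters_frame` (`∀ t` inside, as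
`hIlawV3` is): the same surgery on ✓`ilawV3_block_of_letters` with `hpath` = ✓`jv3Sq_of_ilawAE`'s text.  NET: the (I-law) PATH blocks (X, V3) of row-sq v0.3∕v0.4 follow from
{frame, (I-geo)sq, (β)×2, `Dlink`∣MW, (J-Lip)∣MW, rows} (REG′ side) + {(G₂∕G₃^{prof}) at the path law points, (K1-path), (S-PROF), (SC-PROF-X), masses} (KER′ side) + the
consumer's own frame∕`hpath` binders — the «law facts a.e.» letter is GONE from the list.  INHABITATION (★★OWNER RULING №100; LEAD №29): own-law, discharged in ✓(L51a).

HONEST FRAMING: bookkeeping — `obtain`∕`exact` over landed doors plus ✓(L51a)'s measure theory; every remaining analytic letter is a HYPOTHESIS; nothing of Bałaban's analysis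
is asserted or proved; (I-curv), (I-cov), `OrganDischargeInputsHJ(sq)` ∕ `SpreadFibreLawH(J)(sq)` UNDISCHARGED; the five registered stubs of `Lines/semiclassical_s2beta.lean`,
crux 20520 and `YM3TorusSU2` are NOT proved; registry untouched; rung R3 = SU(2) YM₃ on T³ — NOT d = 4, NOT infinite volume, NOT a mass gap, NOT Clay; the Yang–Mills mass gap
is NOT proved.  [folklore]
-/

set_option autoImplicit false

noncomputable section

namespace Summit.QuantumFields.YangMills.Theorems.OrganTangentILawPathBlocksKnitFrame

open MeasureTheory Set Function
open scoped BigOperators NNReal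
open Literature.MathematicalPhysics.QuantumFieldTheory.Balaban1983to89 T3ContinuumYM3Torus T3NestedUnitLaws
  T3UnitLawDensityEML T4Continuum BalabanUVClass T3UnitScaleTilt T3LevelShift T3TiltDescent
open T4CubeChartExp (expPt)
open Summit.QuantumFields.YangMills.Theorems.BlockAvgCorrector (stokesConst)
open Summit.QuantumFields.YangMills.Theorems.FluctuationComparisonRegPrIntLRunpairOrganFibreLaw (mwCut wNum)
open Summit.QuantumFields.YangMills.Theorems.OrganTangentILawRegOfBetaAndIncr (ilawRegX_of_beta_of_incr ilawRegV3_of_beta_of_incr)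
open Summit.QuantumFields.YangMills.Theorems.OrganTangentILawKerXOfScoreProfile (kerXClause_of_covKernel_profiles)
open Summit.QuantumFields.YangMills.Theorems.OrganTangentILawKerV3OfScoreProfile (kerV3_organ)
open Summit.QuantumFields.YangMills.Theorems.OrganTangentILawPathLawFactsOfReg (lawFactsX_of_reg_at lawFactsV3_of_reg)

variable {ι : Type*} [Fintype ι]

/-- ★★★ **THE (I-law-X)sq BLOCK FROM NAMED LETTERS, «LAW FACTS» STRUCK** — `hIlawX` of ✓`l1jSq_of_ilawAE` VERBATIM (per `t`), hypotheses = ✓p826244 `ilawX_block_of_letters`'s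
with its `hlaw` letter REPLACED by `hmF hΦm hJm hρm hρ'm` + `hpath` (✓`l1jSq_of_ilawAE`'s own knit-side binders); inside: REG′ ✓`ilawRegX_of_beta_of_incr` ⟶ ✓`lawFactsX_of_reg_at` ⟶
✓`kerXClause_of_covKernel_profiles` with the law∕score families frozen at `t`. [folklore] -/
theorem ilawX_block_of_letters_frame (F : T3Family) (γ b₀ p₀ : ℝ) (j Ts : ℕ) (hjTs : j + 1 ≤ Ts)
    (ρ ρ' : (i : ℕ) → GaugeField (F.P i) 0 ↥(Matrix.specialUnitaryGroup (Fin 2) ℂ) → ℝ)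
    (hρc : ContinuousOn (ρ Ts) {U | PlaqSmall (θBal F.L γ b₀ p₀ Ts) U}) (hρ'c : ContinuousOn (ρ' Ts) {U | PlaqSmall (θBal F.L γ b₀ p₀ Ts) U})
    (hρpos : ∀ U, PlaqSmall (θBal F.L γ b₀ p₀ Ts) U → 0 < ρ Ts U ∧ 0 < ρ' Ts U) (hθ : ∀ n, 0 < θBal F.L γ b₀ p₀ n)
    (hχc : Continuous (mwCut F γ b₀ p₀ j Ts))
    (hχsupp : ∀ U, mwCut F γ b₀ p₀ j Ts U ≠ 0 → ∀ (n : ℕ) (hjn : j + 1 ≤ n) (hnK : n ≤ Ts), PlaqSmall (24 / 25 * θBal F.L γ b₀ p₀ n) (descendTo F ℰp n Ts hnK U))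
    (rA Bρ Bρ' : ℝ) (hrA : 0 < rA)
    (hβ : ∀ (U : GaugeField (F.P Ts) 0 ↥(Matrix.specialUnitaryGroup (Fin 2) ℂ)), PlaqSmall (49 / 50 * θBal F.L γ b₀ p₀ Ts) U →
      ∀ (b b' : PBond (F.P Ts) 0) (v v' : Fin 3 → ℝ), ‖v‖ ≤ 1 → ‖v'‖ ≤ 1 →
        ∃ g : ℂ × ℂ → ℂ, DifferentiableOn ℂ g (Metric.ball (0 : ℂ) (rA * (49 / 50 * θBal F.L γ b₀ p₀ Ts)) ×ˢ Metric.ball (0 : ℂ) (rA * (49 / 50 * θBal F.L γ b₀ p₀ Ts))) ∧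
          (∀ (s t : ℝ) (V Z : GaugeField (F.P Ts) 0 ↥(Matrix.specialUnitaryGroup (Fin 2) ℂ)), |s| < rA * (49 / 50 * θBal F.L γ b₀ p₀ Ts) → |t| < rA * (49 / 50 * θBal F.L γ b₀ p₀ Ts) →
            (∀ e, e ≠ b → V e = U e) → V b = U b * expPt (s • v) → (∀ e, e ≠ b' → Z e = V e) → Z b' = V b' * expPt (t • v') →
            g ((s : ℂ), (t : ℂ)) = (((Real.log (ρ Ts Z)) : ℝ) : ℂ)) ∧
          ∀ z ∈ Metric.ball (0 : ℂ) (rA * (49 / 50 * θBal F.L γ b₀ p₀ Ts)) ×ˢ Metric.ball (0 : ℂ) (rA * (49 / 50 * θBal F.L γ b₀ p₀ Ts)), ‖g z - g 0‖ ≤ Bρ)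
    (hβ' : ∀ (U : GaugeField (F.P Ts) 0 ↥(Matrix.specialUnitaryGroup (Fin 2) ℂ)), PlaqSmall (49 / 50 * θBal F.L γ b₀ p₀ Ts) U →
      ∀ (b b' : PBond (F.P Ts) 0) (v v' : Fin 3 → ℝ), ‖v‖ ≤ 1 → ‖v'‖ ≤ 1 →
        ∃ g : ℂ × ℂ → ℂ, DifferentiableOn ℂ g (Metric.ball (0 : ℂ) (rA * (49 / 50 * θBal F.L γ b₀ p₀ Ts)) ×ˢ Metric.ball (0 : ℂ) (rA * (49 / 50 * θBal F.L γ b₀ p₀ Ts))) ∧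
          (∀ (s t : ℝ) (V Z : GaugeField (F.P Ts) 0 ↥(Matrix.specialUnitaryGroup (Fin 2) ℂ)), |s| < rA * (49 / 50 * θBal F.L γ b₀ p₀ Ts) → |t| < rA * (49 / 50 * θBal F.L γ b₀ p₀ Ts) →
            (∀ e, e ≠ b → V e = U e) → V b = U b * expPt (s • v) → (∀ e, e ≠ b' → Z e = V e) → Z b' = V b' * expPt (t • v') →
            g ((s : ℂ), (t : ℂ)) = (((Real.log (ρ' Ts Z)) : ℝ) : ℂ)) ∧
          ∀ z ∈ Metric.ball (0 : ℂ) (rA * (49 / 50 * θBal F.L γ b₀ p₀ Ts)) ×ˢ Metric.ball (0 : ℂ) (rA * (49 / 50 * θBal F.L γ b₀ p₀ Ts)), ‖g z - g 0‖ ≤ Bρ')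
    {Z : Type} [MeasurableSpace Z] (τ : Measure Z) [IsFiniteMeasure τ]
    (Φ : GaugeField (F.P j) 0 ↥(Matrix.specialUnitaryGroup (Fin 2) ℂ) × Z → GaugeField (F.P Ts) 0 ↥(Matrix.specialUnitaryGroup (Fin 2) ℂ))
    (J : GaugeField (F.P j) 0 ↥(Matrix.specialUnitaryGroup (Fin 2) ℂ) × Z → ℝ≥0) (CJ : ℝ) (hJle : ∀ V z, (J (V, z) : ℝ) ≤ CJ)
    (hcont : ∀ f : GaugeField (F.P Ts) 0 ↥(Matrix.specialUnitaryGroup (Fin 2) ℂ) → ℝ, Continuous f →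
      (∀ U, f U ≠ 0 → (∀ (n : ℕ) (hjn : j + 1 ≤ n) (hnK : n ≤ Ts), PlaqSmall (24 / 25 * θBal F.L γ b₀ p₀ n) (descendTo F ℰp n Ts hnK U))) →
      ∀ z, ContinuousOn (fun V => (J (V, z) : ℝ) * f (Φ (V, z))) {V | PlaqSmall (θBal F.L γ b₀ p₀ j) V})
    (hθj : 0 < θBal F.L γ b₀ p₀ j) (rc : ℝ) (hrc : 0 ≤ rc) (hguard : (1 + 16 * Real.sqrt 3 * rc) * (θBal F.L γ b₀ p₀ j / 4) ≤ θBal F.L γ b₀ p₀ j)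
    (KJ : ℝ≥0) {θmax μ K δ : ℝ} (hδ : 0 < δ) (k : PBond (F.P Ts) 0 → ℝ) (hk0 : ∀ e, 0 ≤ k e) (hK : ∑ e, k e ≤ K)
    (hkμ : ∀ e, k e * δ ≤ μ) (hwin : 4 * (Real.sqrt 3 * μ) ≤ θBal F.L γ b₀ p₀ Ts / 50) (hrad : μ < rA * (49 / 50 * θBal F.L γ b₀ p₀ Ts))
    (hθmax0 : 0 ≤ θmax) (hθle : ∀ n', j + 1 ≤ n' → n' ≤ Ts → θBal F.L γ b₀ p₀ n' ≤ θmax)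
    (h24 : stokesConst (F.P Ts) * (24 / 25 * θmax + 4 * ((30 * (((3 + 2) * F.L : ℕ) : ℝ)) ^ (Ts - (j + 1)) * (Real.sqrt 3 * K * δ))) ≤ 1 / 24)
    (hPJ : ∀ (B' : PBond (F.P j) 0) (m' : Fin 3 → ℝ) (U₂ : GaugeField (F.P j) 0 ↥(Matrix.specialUnitaryGroup (Fin 2) ℂ))
      (X : ℝ → GaugeField (F.P j) 0 ↥(Matrix.specialUnitaryGroup (Fin 2) ℂ)), ‖m'‖ ≤ rc * (θBal F.L γ b₀ p₀ j / 4) → PlaqSmall (θBal F.L γ b₀ p₀ j / 4) U₂ →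
      (∀ s e, e ≠ B' → X s e = U₂ e) → (∀ s, X s B' = U₂ B' * expPt (s • m')) → ∀ (z : Z), ∀ x ∈ Set.Ioo (-1 : ℝ) 2, ∀ y ∈ Set.Ioo (-1 : ℝ) 2,
        (∀ r ∈ Set.uIoo x y, ∀ (n : ℕ) (hjn : j + 1 ≤ n) (hnK : n ≤ Ts), PlaqSmall (24 / 25 * θBal F.L γ b₀ p₀ n) (descendTo F ℰp n Ts hnK (Φ (X r, z)))) →
        LipschitzOnWith KJ (fun s => (J (X s, z) : ℝ)) (Set.Ioo (-1 : ℝ) 2 ∩ Set.uIcc x y))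
    (hPincr : ∀ (B' : PBond (F.P j) 0) (m' : Fin 3 → ℝ) (U₂ : GaugeField (F.P j) 0 ↥(Matrix.specialUnitaryGroup (Fin 2) ℂ))
      (X : ℝ → GaugeField (F.P j) 0 ↥(Matrix.specialUnitaryGroup (Fin 2) ℂ)), ‖m'‖ ≤ rc * (θBal F.L γ b₀ p₀ j / 4) → PlaqSmall (θBal F.L γ b₀ p₀ j / 4) U₂ →
      (∀ s e, e ≠ B' → X s e = U₂ e) → (∀ s, X s B' = U₂ B' * expPt (s • m')) → ∀ (z : Z), ∀ x ∈ Set.Ioo (-1 : ℝ) 2, ∀ y ∈ Set.Ioo (-1 : ℝ) 2,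
        (∀ r ∈ Set.uIoo x y, ∀ (n : ℕ) (hjn : j + 1 ≤ n) (hnK : n ≤ Ts), PlaqSmall (24 / 25 * θBal F.L γ b₀ p₀ n) (descendTo F ℰp n Ts hnK (Φ (X r, z)))) →
        ∀ s ∈ Set.Ioo (-1 : ℝ) 2 ∩ Set.uIcc x y, ∀ s' ∈ Set.Ioo (-1 : ℝ) 2 ∩ Set.uIcc x y, |s - s'| ≤ δ →
          ∀ e, ∃ w : Fin 3 → ℝ, Φ (X s', z) e = Φ (X s, z) e * expPt w ∧ ‖w‖ ≤ k e * |s - s'|)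
    (hSJ : ∀ (B B' : PBond (F.P j) 0) (m m' : Fin 3 → ℝ) (V00 : GaugeField (F.P j) 0 ↥(Matrix.specialUnitaryGroup (Fin 2) ℂ))
      (Y : ℝ → GaugeField (F.P j) 0 ↥(Matrix.specialUnitaryGroup (Fin 2) ℂ)) (X : ℝ → ℝ → GaugeField (F.P j) 0 ↥(Matrix.specialUnitaryGroup (Fin 2) ℂ)),
      ‖m‖ ≤ rc * (θBal F.L γ b₀ p₀ j / 4) → ‖m'‖ ≤ rc * (θBal F.L γ b₀ p₀ j / 4) → PlaqSmall (θBal F.L γ b₀ p₀ j / 4) V00 →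
      (∀ s e, e ≠ B → Y s e = V00 e) → (∀ s, Y s B = V00 B * expPt (s • m)) → (∀ s s' e, e ≠ B' → X s s' e = Y s e) → (∀ s s', X s s' B' = Y s B' * expPt (s' • m')) →
      ∀ s' ∈ Set.Icc (0:ℝ) 1, ∀ (z : Z), ∀ x ∈ Set.Ioo (-1 : ℝ) 2, ∀ y ∈ Set.Ioo (-1 : ℝ) 2,
        (∀ r ∈ Set.uIoo x y, ∀ (n : ℕ) (hjn : j + 1 ≤ n) (hnK : n ≤ Ts), PlaqSmall (24 / 25 * θBal F.L γ b₀ p₀ n) (descendTo F ℰp n Ts hnK (Φ (X r s', z)))) →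
        LipschitzOnWith KJ (fun s => (J (X s s', z) : ℝ)) (Set.Ioo (-1 : ℝ) 2 ∩ Set.uIcc x y))
    (hSincr : ∀ (B B' : PBond (F.P j) 0) (m m' : Fin 3 → ℝ) (V00 : GaugeField (F.P j) 0 ↥(Matrix.specialUnitaryGroup (Fin 2) ℂ))
      (Y : ℝ → GaugeField (F.P j) 0 ↥(Matrix.specialUnitaryGroup (Fin 2) ℂ)) (X : ℝ → ℝ → GaugeField (F.P j) 0 ↥(Matrix.specialUnitaryGroup (Fin 2) ℂ)),
      ‖m‖ ≤ rc * (θBal F.L γ b₀ p₀ j / 4) → ‖m'‖ ≤ rc * (θBal F.L γ b₀ p₀ j / 4) → PlaqSmall (θBal F.L γ b₀ p₀ j / 4) V00 →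
      (∀ s e, e ≠ B → Y s e = V00 e) → (∀ s, Y s B = V00 B * expPt (s • m)) → (∀ s s' e, e ≠ B' → X s s' e = Y s e) → (∀ s s', X s s' B' = Y s B' * expPt (s' • m')) →
      ∀ s' ∈ Set.Icc (0:ℝ) 1, ∀ (z : Z), ∀ x ∈ Set.Ioo (-1 : ℝ) 2, ∀ y ∈ Set.Ioo (-1 : ℝ) 2,
        (∀ r ∈ Set.uIoo x y, ∀ (n : ℕ) (hjn : j + 1 ≤ n) (hnK : n ≤ Ts), PlaqSmall (24 / 25 * θBal F.L γ b₀ p₀ n) (descendTo F ℰp n Ts hnK (Φ (X r s', z)))) →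
        ∀ s ∈ Set.Ioo (-1 : ℝ) 2 ∩ Set.uIcc x y, ∀ s'' ∈ Set.Ioo (-1 : ℝ) 2 ∩ Set.uIcc x y, |s - s''| ≤ δ →
          ∀ e, ∃ w : Fin 3 → ℝ, Φ (X s'' s', z) e = Φ (X s s', z) e * expPt w ∧ ‖w‖ ≤ k e * |s - s''|)
    (c : ℝ) (hc : c < 1) (Db : ℝ) (hDb0 : 0 ≤ Db) (DP : Plaq (F.P Ts) 0 → PBond (F.P j) 0 → ℝ) (hDb : ∀ p b, DP p b ≤ Db)
    (hdisp : ∀ (z : Z) (X : GaugeField (F.P j) 0 ↥(Matrix.specialUnitaryGroup (Fin 2) ℂ)), PlaqSmall (θBal F.L γ b₀ p₀ j) X →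
      ∀ (b : PBond (F.P j) 0) (v : Fin 3 → ℝ), ‖v‖ ≤ rc * (θBal F.L γ b₀ p₀ j / 4) → ∀ s ∈ Icc (0 : ℝ) 1, ∀ p : Plaq (F.P Ts) 0,
        dist1 (GaugeField.plaqHol (Φ (update X b (X b * expPt (s • v)), z)) p)
          ≤ dist1 (GaugeField.plaqHol (Φ (X, z)) p) + DP p b * (‖v‖ / (θBal F.L γ b₀ p₀ j / 4)))
    (hroom : 24 / 25 * θBal F.L γ b₀ p₀ Ts + 3 * (Db * rc) ≤ c * θBal F.L γ b₀ p₀ Ts) (t : ℝ) (ht0 : 0 ≤ t) (ht1 : t ≤ 1)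
    -- the KER′ letters of ✓p825419 `kerX_organ`, with the block's mass budget
    (κ NX w : ℝ) (δX : ℕ → ℝ)
    (Prof : GaugeField (F.P j) 0 ↥(Matrix.specialUnitaryGroup (Fin 2) ℂ) → (Z → ℝ) → (ι → ℝ) → Prop)
    (𝒢 : ι → ι → ℝ) (ωf : ι → ι → ℝ) (NG : ℝ) (hG0 : ∀ a c, 0 ≤ 𝒢 a c) (hωf : ∀ a c, 0 ≤ ωf a c) (hNG : 0 ≤ NG)
    (hGrow : ∀ a, ∑ c, 𝒢 a c * ωf a c ≤ NG) (hGcol : ∀ c, ∑ a, 𝒢 a c * ωf a c ≤ NG) (hωfsymm : ∀ a c, ωf a c = ωf c a)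
    (hCov : ∀ t : ℝ, 0 ≤ t → t ≤ 1 → ∀ (B B' : PBond (F.P j) 0) (m m' : Fin 3 → ℝ) (U₁ V₁ W₂ : GaugeField (F.P j) 0 ↥(Matrix.specialUnitaryGroup (Fin 2) ℂ)),
      ‖m‖ ≤ rc * (θBal F.L γ b₀ p₀ j / 4) → ‖m'‖ ≤ rc * (θBal F.L γ b₀ p₀ j / 4) → PlaqSmall (θBal F.L γ b₀ p₀ j / 4) U₁ → PlaqSmall (θBal F.L γ b₀ p₀ j / 4) V₁ →
      PlaqSmall (θBal F.L γ b₀ p₀ j / 4) W₂ →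
      (∀ e, e ≠ B → V₁ e = U₁ e) → V₁ B = U₁ B * expPt m → (∀ e, e ≠ B' → W₂ e = V₁ e) → W₂ B' = V₁ B' * expPt m' →
      ∀ (X : ℝ → GaugeField (F.P j) 0 ↥(Matrix.specialUnitaryGroup (Fin 2) ℂ)), (∀ s e, e ≠ B' → X s e = V₁ e) → (∀ s, X s B' = V₁ B' * expPt (s • m')) →
      ∀ s ∈ Set.Icc (0:ℝ) 1, ∀ (Pf Qf : Z → ℝ) (p q : ι → ℝ), Prof (X s) Pf p → Prof (X s) Qf q → ∀ (cP cQ : ℝ),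
        cP = ∫ z, Pf z * (wNum F γ b₀ p₀ j Ts ρ ρ' Φ J t (X s) z / ∫ z', wNum F γ b₀ p₀ j Ts ρ ρ' Φ J t (X s) z' ∂τ) ∂τ → cQ = ∫ z, Qf z * (wNum F γ b₀ p₀ j Ts ρ ρ' Φ J t (X s) z / ∫ z', wNum F γ b₀ p₀ j Ts ρ ρ' Φ J t (X s) z' ∂τ) ∂τ →
          Integrable (fun z => (Pf z - cP) * (Qf z - cQ) * (wNum F γ b₀ p₀ j Ts ρ ρ' Φ J t (X s) z / ∫ z', wNum F γ b₀ p₀ j Ts ρ ρ' Φ J t (X s) z' ∂τ)) τ ∧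
            |∫ z, (Pf z - cP) * (Qf z - cQ) * (wNum F γ b₀ p₀ j Ts ρ ρ' Φ J t (X s) z / ∫ z', wNum F γ b₀ p₀ j Ts ρ ρ' Φ J t (X s) z' ∂τ) ∂τ| ≤ ∑ a, ∑ c, |p a| * 𝒢 a c * |q c|)
    (K Q₁ : ι → PBond (F.P j) 0 → ℝ) (ωX : ι → PBond (F.P j) 0 → ℝ) (Ncol Nrow : ℝ) (hK0 : ∀ a B, 0 ≤ K a B) (hQ0 : ∀ a B, 0 ≤ Q₁ a B) (hωX : ∀ a B, 0 ≤ ωX a B)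
    (hNcol : 0 ≤ Ncol) (hNrow : 0 ≤ Nrow)
    (hKcol : ∀ B, ∑ a, K a B * ωX a B ≤ Ncol) (hKrow : ∀ c, ∑ B', K c B' * ωX c B' ≤ Ncol)
    (hQrow : ∀ c, ∑ B', Q₁ c B' * ωX c B' ≤ Nrow) (hQcol : ∀ B, ∑ a, Q₁ a B * ωX a B ≤ Nrow)
    (htri : ∀ (B B' : PBond (F.P j) 0) (a c : ι), Real.exp (κ * (B.src.tdist B'.src : ℝ)) ≤ ωX a B * ωf a c * ωX c B')
    (htdsymm : ∀ B B' : PBond (F.P j) 0, (B.src.tdist B'.src : ℝ) = (B'.src.tdist B.src : ℝ))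
    (hProfF : ∀ t : ℝ, 0 ≤ t → t ≤ 1 → ∀ (B B' : PBond (F.P j) 0) (m m' : Fin 3 → ℝ) (U₁ V₁ W₂ : GaugeField (F.P j) 0 ↥(Matrix.specialUnitaryGroup (Fin 2) ℂ)),
      ‖m‖ ≤ rc * (θBal F.L γ b₀ p₀ j / 4) → ‖m'‖ ≤ rc * (θBal F.L γ b₀ p₀ j / 4) → PlaqSmall (θBal F.L γ b₀ p₀ j / 4) U₁ → PlaqSmall (θBal F.L γ b₀ p₀ j / 4) V₁ →
      PlaqSmall (θBal F.L γ b₀ p₀ j / 4) W₂ →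
      (∀ e, e ≠ B → V₁ e = U₁ e) → V₁ B = U₁ B * expPt m → (∀ e, e ≠ B' → W₂ e = V₁ e) → W₂ B' = V₁ B' * expPt m' →
      ∀ (X : ℝ → GaugeField (F.P j) 0 ↥(Matrix.specialUnitaryGroup (Fin 2) ℂ)), (∀ s e, e ≠ B' → X s e = V₁ e) → (∀ s, X s B' = V₁ B' * expPt (s • m')) →
      ∀ s ∈ Set.Icc (0:ℝ) 1,
        Prof (X s) (fun z => (Real.log (ρ Ts (Φ (V₁, z))) - Real.log (ρ' Ts (Φ (V₁, z)))) - (Real.log (ρ Ts (Φ (U₁, z))) - Real.log (ρ' Ts (Φ (U₁, z)))))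
            (fun a => ‖m‖ / (θBal F.L γ b₀ p₀ j / 4) * K a B) ∧
          Prof (X s) (fun z => deriv (fun s => wNum F γ b₀ p₀ j Ts ρ ρ' Φ J t (X s) z) s / wNum F γ b₀ p₀ j Ts ρ ρ' Φ J t (X s) z) (fun a => ‖m'‖ / (θBal F.L γ b₀ p₀ j / 4) * Q₁ a B'))
    -- the law facts are the FRAME'S (✓`lawFactsX_of_reg_at`): frame measurability + the knit-side `hpath` (✓`l1jSq_of_ilawAE`'s text VERBATIM) replace ✓p826244's `hlaw`
    (hmF : ∀ (V : GaugeField (F.P j) 0 ↥(Matrix.specialUnitaryGroup (Fin 2) ℂ)), AEStronglyMeasurable (fun z => Real.log (ρ Ts (Φ (V, z))) - Real.log (ρ' Ts (Φ (V, z)))) τ)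
    (hΦm : Measurable Φ) (hJm : Measurable J) (hρm : Measurable (ρ Ts)) (hρ'm : Measurable (ρ' Ts))
    (hpath : ∀ (B B' : PBond (F.P j) 0) (m m' : Fin 3 → ℝ) (U₁ V₁ : GaugeField (F.P j) 0 ↥(Matrix.specialUnitaryGroup (Fin 2) ℂ)) (X : ℝ → GaugeField (F.P j) 0 ↥(Matrix.specialUnitaryGroup (Fin 2) ℂ)), ‖m‖ ≤ rc * (θBal F.L γ b₀ p₀ j / 4) → ‖m'‖ ≤ rc * (θBal F.L γ b₀ p₀ j / 4) →
      PlaqSmall (θBal F.L γ b₀ p₀ j / 4) U₁ → PlaqSmall (θBal F.L γ b₀ p₀ j / 4) V₁ → (∀ e, e ≠ B → V₁ e = U₁ e) → V₁ B = U₁ B * expPt m → (∀ s e, e ≠ B' → X s e = V₁ e) → (∀ s, X s B' = V₁ B' * expPt (s • m')) →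
      ∀ s ∈ Set.Icc (0:ℝ) 1, Integrable (fun z => wNum F γ b₀ p₀ j Ts ρ ρ' Φ J t (X s) z) τ ∧ Integrable (fun z => (Real.log (ρ Ts (Φ (U₁, z))) - Real.log (ρ' Ts (Φ (U₁, z)))) * wNum F γ b₀ p₀ j Ts ρ ρ' Φ J t (X s) z) τ ∧
        Integrable (fun z => (Real.log (ρ Ts (Φ (V₁, z))) - Real.log (ρ' Ts (Φ (V₁, z)))) * wNum F γ b₀ p₀ j Ts ρ ρ' Φ J t (X s) z) τ ∧ ∫ z, wNum F γ b₀ p₀ j Ts ρ ρ' Φ J t (X s) z ∂τ ≠ 0)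
    (hM : Ncol * NG * Nrow ≤ NX * ((((F.L : ℝ) ^ j / γ) * θBal F.L γ b₀ p₀ j ^ 2) / (((F.L : ℝ) ^ Ts / γ) * θBal F.L γ b₀ p₀ Ts ^ 2)) * w + δX j * (((F.L : ℝ) ^ j / γ) * θBal F.L γ b₀ p₀ j ^ 2)) :
    ∃ kX : PBond (F.P j) 0 → PBond (F.P j) 0 → ℝ, (∀ B B', 0 ≤ kX B B') ∧ (∀ B, ∑ B', kX B B' * Real.exp (κ * (B.src.tdist B'.src : ℝ)) ≤ NX * ((((F.L : ℝ) ^ j / γ) * θBal F.L γ b₀ p₀ j ^ 2) / (((F.L : ℝ) ^ Ts / γ) * θBal F.L γ b₀ p₀ Ts ^ 2)) * w + δX j * (((F.L : ℝ) ^ j / γ) * θBal F.L γ b₀ p₀ j ^ 2)) ∧ (∀ B', ∑ B, kX B B' * Real.exp (κ * (B.src.tdist B'.src : ℝ)) ≤ NX * ((((F.L : ℝ) ^ j / γ) * θBal F.L γ b₀ p₀ j ^ 2) / (((F.L : ℝ) ^ Ts / γ) * θBal F.L γ b₀ p₀ Ts ^ 2)) * w + δX j * (((F.L : ℝ) ^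 j / γ) * θBal F.L γ b₀ p₀ j ^ 2)) ∧
      (∀ (B B' : PBond (F.P j) 0) (m m' : Fin 3 → ℝ) (U₁ V₁ W₂ : GaugeField (F.P j) 0 ↥(Matrix.specialUnitaryGroup (Fin 2) ℂ)), ‖m‖ ≤ rc * (θBal F.L γ b₀ p₀ j / 4) → ‖m'‖ ≤ rc * (θBal F.L γ b₀ p₀ j / 4) → PlaqSmall (θBal F.L γ b₀ p₀ j / 4) U₁ → PlaqSmall (θBal F.L γ b₀ p₀ j / 4) V₁ → PlaqSmall (θBal F.L γ b₀ p₀ j / 4) W₂ → (∀ e, e ≠ B → V₁ e = U₁ e) → V₁ B = U₁ B * expPt m → (∀ e, e ≠ B' → W₂ e = V₁ e) → W₂ B' = V₁ B' * expPt m' → ∀ (X : ℝ → GaugeField (F.P j) 0 ↥(Matrix.specialUnitaryGroup (Fin 2) ℂ)), (∀ s e, e ≠ B' → X s e = V₁ e) → (∀ s, X s B' = V₁ B' * expPt (s • m')) →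
          (∃ (b bΔ : Z → ℝ), Integrable b τ ∧ Integrable bΔ τ ∧
            (∀ᵐ z ∂τ, LipschitzOnWith (Real.nnabs (b z)) (fun s => wNum F γ b₀ p₀ j Ts ρ ρ' Φ J t (X s) z) (Set.Ioo (-1) 2)) ∧
            (∀ᵐ z ∂τ, LipschitzOnWith (Real.nnabs (bΔ z)) (fun s => ((Real.log (ρ Ts (Φ (V₁, z))) - Real.log (ρ' Ts (Φ (V₁, z)))) - (Real.log (ρ Ts (Φ (U₁, z))) - Real.log (ρ' Ts (Φ (U₁, z))))) * wNum F γ b₀ p₀ j Ts ρ ρ' Φ J t (X s) z) (Set.Ioo (-1) 2))) ∧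
            (∀ᵐ s ∂(volume : Measure ℝ), s ∈ Set.Icc (0:ℝ) 1 → |(∫ z, ((Real.log (ρ Ts (Φ (V₁, z))) - Real.log (ρ' Ts (Φ (V₁, z)))) - (Real.log (ρ Ts (Φ (U₁, z))) - Real.log (ρ' Ts (Φ (U₁, z))))) * (deriv (fun s => wNum F γ b₀ p₀ j Ts ρ ρ' Φ J t (X s) z) s / wNum F γ b₀ p₀ j Ts ρ ρ' Φ J t (X s) z) * (wNum F γ b₀ p₀ j Ts ρ ρ' Φ J t (X s) z / ∫ z', wNum F γ b₀ p₀ j Ts ρ ρ' Φ J t (X s) z' ∂τ) ∂τ)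
                - (∫ z, ((Real.log (ρ Ts (Φ (V₁, z))) - Real.log (ρ' Ts (Φ (V₁, z)))) - (Real.log (ρ Ts (Φ (U₁, z))) - Real.log (ρ' Ts (Φ (U₁, z))))) * (wNum F γ b₀ p₀ j Ts ρ ρ' Φ J t (X s) z / ∫ z', wNum F γ b₀ p₀ j Ts ρ ρ' Φ J t (X s) z' ∂τ) ∂τ) * (∫ z, (deriv (fun s => wNum F γ b₀ p₀ j Ts ρ ρ' Φ J t (X s) z) s / wNum F γ b₀ p₀ j Ts ρ ρ' Φ J t (X s) z) * (wNum F γ b₀ p₀ j Ts ρ ρ' Φ J t (X s) z / ∫ z', wNum F γ b₀ p₀ j Ts ρ ρ' Φ J t (X s) z' ∂τ) ∂τ)| ≤ kX B B' * (‖m‖ / (θBal F.L γ b₀ p₀ j / 4)) * (‖m'‖ / (θBal F.L γ b₀ p₀ j / 4)))) := by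
  have hreg := ilawRegX_of_beta_of_incr F γ b₀ p₀ j Ts hjTs ρ ρ' hρc hρ'c hρpos hθ hχc hχsupp rA Bρ Bρ' hrA hβ hβ' τ Φ J CJ hJle hcont hθj rc hrc hguard
      KJ hδ k hk0 hK hkμ hwin hrad hθmax0 hθle h24 hPJ hPincr hSJ hSincr c hc Db hDb0 DP hDb hdisp hroom t ht0 ht1
  have hlawt := lawFactsX_of_reg_at F γ b₀ p₀ j Ts ρ ρ' τ Φ J rc hmF hΦm hJm hρm hρ'm hχc t hpath hreg
  obtain ⟨kX, h0, hrow, hcol, hker⟩ := kerXClause_of_covKernel_profiles τ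
    (fun V z => Real.log (ρ Ts (Φ (V, z))) - Real.log (ρ' Ts (Φ (V, z))))
    (fun _ Xw z => wNum F γ b₀ p₀ j Ts ρ ρ' Φ J t Xw z / ∫ z', wNum F γ b₀ p₀ j Ts ρ ρ' Φ J t Xw z' ∂τ)
    (fun _ X s z => deriv (fun s => wNum F γ b₀ p₀ j Ts ρ ρ' Φ J t (X s) z) s / wNum F γ b₀ p₀ j Ts ρ ρ' Φ J t (X s) z)
    (θBal F.L γ b₀ p₀ j / 4) rc κ
    (NX * ((((F.L : ℝ) ^ j / γ) * θBal F.L γ b₀ p₀ j ^ 2) / (((F.L : ℝ) ^ Ts / γ) * θBal F.L γ b₀ p₀ Ts ^ 2)) * w + δX j * (((F.L : ℝ) ^ j / γ) * θBal F.L γ b₀ p₀ j ^ 2))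
    (by positivity) Prof 𝒢 ωf NG hG0 hωf hNG hGrow hGcol hωfsymm (fun _ _ _ => hCov t ht0 ht1) K Q₁ ωX Ncol Nrow hK0 hQ0 hωX hNcol hNrow
    hKcol hKrow hQrow hQcol htri htdsymm (fun _ _ _ => hProfF t ht0 ht1) (fun _ _ _ => hlawt) hM
  exact ⟨kX, h0, hrow, hcol, fun B B' m m' U₁ V₁ W₂ hm hm' hU hV hW hVU hVB hWU hWB X hoff hon =>
    ⟨hreg B B' m m' U₁ V₁ W₂ hm hm' hU hV hW hVU hVB hWU hWB X hoff hon, hker t ht0 ht1 B B' m m' U₁ V₁ W₂ hm hm' hU hV hW hVU hVB hWU hWB X hoff hon⟩⟩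

/-- ★★★ **THE (I-law-V3)sq BLOCK FROM NAMED LETTERS, «LAW FACTS» STRUCK** — `hIlawV3` of ✓`jv3Sq_of_ilawAE` VERBATIM (`∀ t` inside), hypotheses = ✓p826244
`ilawV3_block_of_letters`'s with its `hlaw` letter REPLACED by `hmF hΦm hJm hρm hρ'm` + `hpath` (✓`jv3Sq_of_ilawAE`'s own knit-side binders); inside: REG′ ✓`ilawRegV3_of_beta_of_incr`
⟶ ✓`lawFactsV3_of_reg` ⟶ ✓`kerV3_organ`. [folklore] -/
theorem ilawV3_block_of_letters_frame (F : T3Family) (γ b₀ p₀ : ℝ) (j Ts : ℕ) (hjTs : j + 1 ≤ Ts)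
    (ρ ρ' : (i : ℕ) → GaugeField (F.P i) 0 ↥(Matrix.specialUnitaryGroup (Fin 2) ℂ) → ℝ)
    (hρc : ContinuousOn (ρ Ts) {U | PlaqSmall (θBal F.L γ b₀ p₀ Ts) U}) (hρ'c : ContinuousOn (ρ' Ts) {U | PlaqSmall (θBal F.L γ b₀ p₀ Ts) U})
    (hρpos : ∀ U, PlaqSmall (θBal F.L γ b₀ p₀ Ts) U → 0 < ρ Ts U ∧ 0 < ρ' Ts U) (hθ : ∀ n, 0 < θBal F.L γ b₀ p₀ n)
    (hχc : Continuous (mwCut F γ b₀ p₀ j Ts))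
    (hχsupp : ∀ U, mwCut F γ b₀ p₀ j Ts U ≠ 0 → ∀ (n : ℕ) (hjn : j + 1 ≤ n) (hnK : n ≤ Ts), PlaqSmall (24 / 25 * θBal F.L γ b₀ p₀ n) (descendTo F ℰp n Ts hnK U))
    (rA Bρ Bρ' : ℝ) (hrA : 0 < rA)
    (hβ : ∀ (U : GaugeField (F.P Ts) 0 ↥(Matrix.specialUnitaryGroup (Fin 2) ℂ)), PlaqSmall (49 / 50 * θBal F.L γ b₀ p₀ Ts) U →
      ∀ (b b' : PBond (F.P Ts) 0) (v v' : Fin 3 → ℝ), ‖v‖ ≤ 1 → ‖v'‖ ≤ 1 →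
        ∃ g : ℂ × ℂ → ℂ, DifferentiableOn ℂ g (Metric.ball (0 : ℂ) (rA * (49 / 50 * θBal F.L γ b₀ p₀ Ts)) ×ˢ Metric.ball (0 : ℂ) (rA * (49 / 50 * θBal F.L γ b₀ p₀ Ts))) ∧
          (∀ (s t : ℝ) (V Z : GaugeField (F.P Ts) 0 ↥(Matrix.specialUnitaryGroup (Fin 2) ℂ)), |s| < rA * (49 / 50 * θBal F.L γ b₀ p₀ Ts) → |t| < rA * (49 / 50 * θBal F.L γ b₀ p₀ Ts) →
            (∀ e, e ≠ b → V e = U e) → V b = U b * expPt (s • v) → (∀ e, e ≠ b' → Z e = V e) → Z b' = V b' * expPt (t • v') →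
            g ((s : ℂ), (t : ℂ)) = (((Real.log (ρ Ts Z)) : ℝ) : ℂ)) ∧
          ∀ z ∈ Metric.ball (0 : ℂ) (rA * (49 / 50 * θBal F.L γ b₀ p₀ Ts)) ×ˢ Metric.ball (0 : ℂ) (rA * (49 / 50 * θBal F.L γ b₀ p₀ Ts)), ‖g z - g 0‖ ≤ Bρ)
    (hβ' : ∀ (U : GaugeField (F.P Ts) 0 ↥(Matrix.specialUnitaryGroup (Fin 2) ℂ)), PlaqSmall (49 / 50 * θBal F.L γ b₀ p₀ Ts) U →
      ∀ (b b' : PBond (F.P Ts) 0) (v v' : Fin 3 → ℝ), ‖v‖ ≤ 1 → ‖v'‖ ≤ 1 →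
        ∃ g : ℂ × ℂ → ℂ, DifferentiableOn ℂ g (Metric.ball (0 : ℂ) (rA * (49 / 50 * θBal F.L γ b₀ p₀ Ts)) ×ˢ Metric.ball (0 : ℂ) (rA * (49 / 50 * θBal F.L γ b₀ p₀ Ts))) ∧
          (∀ (s t : ℝ) (V Z : GaugeField (F.P Ts) 0 ↥(Matrix.specialUnitaryGroup (Fin 2) ℂ)), |s| < rA * (49 / 50 * θBal F.L γ b₀ p₀ Ts) → |t| < rA * (49 / 50 * θBal F.L γ b₀ p₀ Ts) →
            (∀ e, e ≠ b → V e = U e) → V b = U b * expPt (s • v) → (∀ e, e ≠ b' → Z e = V e) → Z b' = V b' * expPt (t • v') →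
            g ((s : ℂ), (t : ℂ)) = (((Real.log (ρ' Ts Z)) : ℝ) : ℂ)) ∧
          ∀ z ∈ Metric.ball (0 : ℂ) (rA * (49 / 50 * θBal F.L γ b₀ p₀ Ts)) ×ˢ Metric.ball (0 : ℂ) (rA * (49 / 50 * θBal F.L γ b₀ p₀ Ts)), ‖g z - g 0‖ ≤ Bρ')
    {Z : Type} [MeasurableSpace Z] (τ : Measure Z) [IsFiniteMeasure τ]
    (Φ : GaugeField (F.P j) 0 ↥(Matrix.specialUnitaryGroup (Fin 2) ℂ) × Z → GaugeField (F.P Ts) 0 ↥(Matrix.specialUnitaryGroup (Fin 2) ℂ))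
    (J : GaugeField (F.P j) 0 ↥(Matrix.specialUnitaryGroup (Fin 2) ℂ) × Z → ℝ≥0) (CJ : ℝ) (hJle : ∀ V z, (J (V, z) : ℝ) ≤ CJ)
    (hcont : ∀ f : GaugeField (F.P Ts) 0 ↥(Matrix.specialUnitaryGroup (Fin 2) ℂ) → ℝ, Continuous f →
      (∀ U, f U ≠ 0 → (∀ (n : ℕ) (hjn : j + 1 ≤ n) (hnK : n ≤ Ts), PlaqSmall (24 / 25 * θBal F.L γ b₀ p₀ n) (descendTo F ℰp n Ts hnK U))) →
      ∀ z, ContinuousOn (fun V => (J (V, z) : ℝ) * f (Φ (V, z))) {V | PlaqSmall (θBal F.L γ b₀ p₀ j) V})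
    (hθj : 0 < θBal F.L γ b₀ p₀ j) (rc : ℝ) (hrc : 0 ≤ rc) (hguard : (1 + 16 * Real.sqrt 3 * rc) * (θBal F.L γ b₀ p₀ j / 4) ≤ θBal F.L γ b₀ p₀ j)
    (KJ : ℝ≥0) {θmax μ K δ : ℝ} (hδ : 0 < δ) (k : PBond (F.P Ts) 0 → ℝ) (hk0 : ∀ e, 0 ≤ k e) (hK : ∑ e, k e ≤ K)
    (hkμ : ∀ e, k e * δ ≤ μ) (hwin : 4 * (Real.sqrt 3 * μ) ≤ θBal F.L γ b₀ p₀ Ts / 50) (hrad : μ < rA * (49 / 50 * θBal F.L γ b₀ p₀ Ts))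
    (hθmax0 : 0 ≤ θmax) (hθle : ∀ n', j + 1 ≤ n' → n' ≤ Ts → θBal F.L γ b₀ p₀ n' ≤ θmax)
    (h24 : stokesConst (F.P Ts) * (24 / 25 * θmax + 4 * ((30 * (((3 + 2) * F.L : ℕ) : ℝ)) ^ (Ts - (j + 1)) * (Real.sqrt 3 * K * δ))) ≤ 1 / 24)
    (hPJ : ∀ (B' : PBond (F.P j) 0) (m' : Fin 3 → ℝ) (U₂ : GaugeField (F.P j) 0 ↥(Matrix.specialUnitaryGroup (Fin 2) ℂ))
      (X : ℝ → GaugeField (F.P j) 0 ↥(Matrix.specialUnitaryGroup (Fin 2) ℂ)), ‖m'‖ ≤ rc * (θBal F.L γ b₀ p₀ j / 4) → PlaqSmall (θBal F.L γ b₀ p₀ j / 4) U₂ →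
      (∀ s e, e ≠ B' → X s e = U₂ e) → (∀ s, X s B' = U₂ B' * expPt (s • m')) → ∀ (z : Z), ∀ x ∈ Set.Ioo (-1 : ℝ) 2, ∀ y ∈ Set.Ioo (-1 : ℝ) 2,
        (∀ r ∈ Set.uIoo x y, ∀ (n : ℕ) (hjn : j + 1 ≤ n) (hnK : n ≤ Ts), PlaqSmall (24 / 25 * θBal F.L γ b₀ p₀ n) (descendTo F ℰp n Ts hnK (Φ (X r, z)))) →
        LipschitzOnWith KJ (fun s => (J (X s, z) : ℝ)) (Set.Ioo (-1 : ℝ) 2 ∩ Set.uIcc x y))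
    (hPincr : ∀ (B' : PBond (F.P j) 0) (m' : Fin 3 → ℝ) (U₂ : GaugeField (F.P j) 0 ↥(Matrix.specialUnitaryGroup (Fin 2) ℂ))
      (X : ℝ → GaugeField (F.P j) 0 ↥(Matrix.specialUnitaryGroup (Fin 2) ℂ)), ‖m'‖ ≤ rc * (θBal F.L γ b₀ p₀ j / 4) → PlaqSmall (θBal F.L γ b₀ p₀ j / 4) U₂ →
      (∀ s e, e ≠ B' → X s e = U₂ e) → (∀ s, X s B' = U₂ B' * expPt (s • m')) → ∀ (z : Z), ∀ x ∈ Set.Ioo (-1 : ℝ) 2, ∀ y ∈ Set.Ioo (-1 : ℝ) 2,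
        (∀ r ∈ Set.uIoo x y, ∀ (n : ℕ) (hjn : j + 1 ≤ n) (hnK : n ≤ Ts), PlaqSmall (24 / 25 * θBal F.L γ b₀ p₀ n) (descendTo F ℰp n Ts hnK (Φ (X r, z)))) →
        ∀ s ∈ Set.Ioo (-1 : ℝ) 2 ∩ Set.uIcc x y, ∀ s' ∈ Set.Ioo (-1 : ℝ) 2 ∩ Set.uIcc x y, |s - s'| ≤ δ →
          ∀ e, ∃ w : Fin 3 → ℝ, Φ (X s', z) e = Φ (X s, z) e * expPt w ∧ ‖w‖ ≤ k e * |s - s'|)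
    (hSJ : ∀ (B B' : PBond (F.P j) 0) (m m' : Fin 3 → ℝ) (V00 : GaugeField (F.P j) 0 ↥(Matrix.specialUnitaryGroup (Fin 2) ℂ))
      (Y : ℝ → GaugeField (F.P j) 0 ↥(Matrix.specialUnitaryGroup (Fin 2) ℂ)) (X : ℝ → ℝ → GaugeField (F.P j) 0 ↥(Matrix.specialUnitaryGroup (Fin 2) ℂ)),
      ‖m‖ ≤ rc * (θBal F.L γ b₀ p₀ j / 4) → ‖m'‖ ≤ rc * (θBal F.L γ b₀ p₀ j / 4) → PlaqSmall (θBal F.L γ b₀ p₀ j / 4) V00 →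
      (∀ s e, e ≠ B → Y s e = V00 e) → (∀ s, Y s B = V00 B * expPt (s • m)) → (∀ s s' e, e ≠ B' → X s s' e = Y s e) → (∀ s s', X s s' B' = Y s B' * expPt (s' • m')) →
      ∀ s' ∈ Set.Icc (0:ℝ) 1, ∀ (z : Z), ∀ x ∈ Set.Ioo (-1 : ℝ) 2, ∀ y ∈ Set.Ioo (-1 : ℝ) 2,
        (∀ r ∈ Set.uIoo x y, ∀ (n : ℕ) (hjn : j + 1 ≤ n) (hnK : n ≤ Ts), PlaqSmall (24 / 25 * θBal F.L γ b₀ p₀ n) (descendTo F ℰp n Ts hnK (Φ (X r s', z)))) →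
        LipschitzOnWith KJ (fun s => (J (X s s', z) : ℝ)) (Set.Ioo (-1 : ℝ) 2 ∩ Set.uIcc x y))
    (hSincr : ∀ (B B' : PBond (F.P j) 0) (m m' : Fin 3 → ℝ) (V00 : GaugeField (F.P j) 0 ↥(Matrix.specialUnitaryGroup (Fin 2) ℂ))
      (Y : ℝ → GaugeField (F.P j) 0 ↥(Matrix.specialUnitaryGroup (Fin 2) ℂ)) (X : ℝ → ℝ → GaugeField (F.P j) 0 ↥(Matrix.specialUnitaryGroup (Fin 2) ℂ)),
      ‖m‖ ≤ rc * (θBal F.L γ b₀ p₀ j / 4) → ‖m'‖ ≤ rc * (θBal F.L γ b₀ p₀ j / 4) → PlaqSmall (θBal F.L γ b₀ p₀ j / 4) V00 →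
      (∀ s e, e ≠ B → Y s e = V00 e) → (∀ s, Y s B = V00 B * expPt (s • m)) → (∀ s s' e, e ≠ B' → X s s' e = Y s e) → (∀ s s', X s s' B' = Y s B' * expPt (s' • m')) →
      ∀ s' ∈ Set.Icc (0:ℝ) 1, ∀ (z : Z), ∀ x ∈ Set.Ioo (-1 : ℝ) 2, ∀ y ∈ Set.Ioo (-1 : ℝ) 2,
        (∀ r ∈ Set.uIoo x y, ∀ (n : ℕ) (hjn : j + 1 ≤ n) (hnK : n ≤ Ts), PlaqSmall (24 / 25 * θBal F.L γ b₀ p₀ n) (descendTo F ℰp n Ts hnK (Φ (X r s', z)))) →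
        ∀ s ∈ Set.Ioo (-1 : ℝ) 2 ∩ Set.uIcc x y, ∀ s'' ∈ Set.Ioo (-1 : ℝ) 2 ∩ Set.uIcc x y, |s - s''| ≤ δ →
          ∀ e, ∃ w : Fin 3 → ℝ, Φ (X s'' s', z) e = Φ (X s s', z) e * expPt w ∧ ‖w‖ ≤ k e * |s - s''|)
    (c : ℝ) (hc : c < 1) (Db : ℝ) (hDb0 : 0 ≤ Db) (DP : Plaq (F.P Ts) 0 → PBond (F.P j) 0 → ℝ) (hDb : ∀ p b, DP p b ≤ Db)
    (hdisp : ∀ (z : Z) (X : GaugeField (F.P j) 0 ↥(Matrix.specialUnitaryGroup (Fin 2) ℂ)), PlaqSmall (θBal F.L γ b₀ p₀ j) X →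
      ∀ (b : PBond (F.P j) 0) (v : Fin 3 → ℝ), ‖v‖ ≤ rc * (θBal F.L γ b₀ p₀ j / 4) → ∀ s ∈ Icc (0 : ℝ) 1, ∀ p : Plaq (F.P Ts) 0,
        dist1 (GaugeField.plaqHol (Φ (update X b (X b * expPt (s • v)), z)) p)
          ≤ dist1 (GaugeField.plaqHol (Φ (X, z)) p) + DP p b * (‖v‖ / (θBal F.L γ b₀ p₀ j / 4)))
    (hroom : 24 / 25 * θBal F.L γ b₀ p₀ Ts + 3 * (Db * rc) ≤ c * θBal F.L γ b₀ p₀ Ts)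
    -- the KER′ letters of ✓p825783 `kerV3_organ`, with the block's mass budget
    (κ NV3 w : ℝ) (δV3 : ℕ → ℝ)
    (Prof : GaugeField (F.P j) 0 ↥(Matrix.specialUnitaryGroup (Fin 2) ℂ) → (Z → ℝ) → (ι → ℝ) → Prop)
    -- (G₃^{prof}) the third central moment kernel at the PATH law points, observables profiled there, t-uniform; masses of its `KS`-contraction
    (𝒢₃ : ι → ι → ι → ℝ) (KS : ι → ℝ) (ωf : ι → ι → ℝ) (NG : ℝ) (hG0 : ∀ a b c, 0 ≤ 𝒢₃ a b c) (hKS0 : ∀ b, 0 ≤ KS b) (hωf : ∀ a c, 0 ≤ ωf a c) (hNG : 0 ≤ NG)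
    (hGrow : ∀ a, ∑ c, (∑ b, KS b * 𝒢₃ a b c) * ωf a c ≤ NG) (hGcol : ∀ c, ∑ a, (∑ b, KS b * 𝒢₃ a b c) * ωf a c ≤ NG) (hωfsymm : ∀ a c, ωf a c = ωf c a)
    (hCum : ∀ t : ℝ, 0 ≤ t → t ≤ 1 → ∀ (B B' : PBond (F.P j) 0) (m m' : Fin 3 → ℝ) (U₁ V₁ W₂ : GaugeField (F.P j) 0 ↥(Matrix.specialUnitaryGroup (Fin 2) ℂ)),
      ‖m‖ ≤ rc * (θBal F.L γ b₀ p₀ j / 4) → ‖m'‖ ≤ rc * (θBal F.L γ b₀ p₀ j / 4) → PlaqSmall (θBal F.L γ b₀ p₀ j / 4) U₁ → PlaqSmall (θBal F.L γ b₀ p₀ j / 4) V₁ → PlaqSmall (θBal F.L γ b₀ p₀ j / 4) W₂ →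
      (∀ e, e ≠ B → V₁ e = U₁ e) → V₁ B = U₁ B * expPt m → (∀ e, e ≠ B' → W₂ e = V₁ e) → W₂ B' = V₁ B' * expPt m' →
      ∀ (X : ℝ → GaugeField (F.P j) 0 ↥(Matrix.specialUnitaryGroup (Fin 2) ℂ)), (∀ s e, e ≠ B' → X s e = V₁ e) → (∀ s, X s B' = V₁ B' * expPt (s • m')) →
      ∀ s ∈ Set.Icc (0:ℝ) 1, ∀ (Pf Qf Rf : Z → ℝ) (p q r : ι → ℝ), Prof (X s) Pf p → Prof (X s) Qf q → Prof (X s) Rf r → ∀ (cP cQ cR : ℝ),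
        cP = ∫ z, Pf z * (wNum F γ b₀ p₀ j Ts ρ ρ' Φ J t (X s) z / ∫ z', wNum F γ b₀ p₀ j Ts ρ ρ' Φ J t (X s) z' ∂τ) ∂τ →
        cQ = ∫ z, Qf z * (wNum F γ b₀ p₀ j Ts ρ ρ' Φ J t (X s) z / ∫ z', wNum F γ b₀ p₀ j Ts ρ ρ' Φ J t (X s) z' ∂τ) ∂τ → cR = ∫ z, Rf z * (wNum F γ b₀ p₀ j Ts ρ ρ' Φ J t (X s) z / ∫ z', wNum F γ b₀ p₀ j Ts ρ ρ' Φ J t (X s) z' ∂τ) ∂τ →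
          Integrable (fun z => (Pf z - cP) * (Qf z - cQ) * (Rf z - cR) * (wNum F γ b₀ p₀ j Ts ρ ρ' Φ J t (X s) z / ∫ z', wNum F γ b₀ p₀ j Ts ρ ρ' Φ J t (X s) z' ∂τ)) τ ∧
            |∫ z, (Pf z - cP) * (Qf z - cQ) * (Rf z - cR) * (wNum F γ b₀ p₀ j Ts ρ ρ' Φ J t (X s) z / ∫ z', wNum F γ b₀ p₀ j Ts ρ ρ' Φ J t (X s) z' ∂τ) ∂τ| ≤ ∑ a, ∑ b, ∑ c, |p a| * |q b| * |r c| * 𝒢₃ a b c)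
    -- (K1-path) ∕ (SC-PROF-X): profiles of the transported difference and of the score at the path law points; their masses
    (K Q₁ : ι → PBond (F.P j) 0 → ℝ) (ωX : ι → PBond (F.P j) 0 → ℝ) (Ncol Nrow : ℝ) (hK0 : ∀ a B, 0 ≤ K a B) (hQ0 : ∀ a B, 0 ≤ Q₁ a B) (hωX : ∀ a B, 0 ≤ ωX a B)
    (hNcol : 0 ≤ Ncol) (hNrow : 0 ≤ Nrow)
    (hKcol : ∀ B, ∑ a, K a B * ωX a B ≤ Ncol) (hKrow : ∀ c, ∑ B', K c B' * ωX c B' ≤ Ncol)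
    (hQrow : ∀ c, ∑ B', Q₁ c B' * ωX c B' ≤ Nrow) (hQcol : ∀ B, ∑ a, Q₁ a B * ωX a B ≤ Nrow)
    (htri : ∀ (B B' : PBond (F.P j) 0) (a c : ι), Real.exp (κ * (B.src.tdist B'.src : ℝ)) ≤ ωX a B * ωf a c * ωX c B')
    (htdsymm : ∀ B B' : PBond (F.P j) 0, (B.src.tdist B'.src : ℝ) = (B'.src.tdist B.src : ℝ))
    -- (K1-path) ∧ (S-PROF) ∧ (SC-PROF-X) at the path law points
    (hProfF : ∀ t : ℝ, 0 ≤ t → t ≤ 1 → ∀ (B B' : PBond (F.P j) 0) (m m' : Fin 3 → ℝ) (U₁ V₁ W₂ : GaugeField (F.P j) 0 ↥(Matrix.specialUnitaryGroup (Fin 2) ℂ)),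
      ‖m‖ ≤ rc * (θBal F.L γ b₀ p₀ j / 4) → ‖m'‖ ≤ rc * (θBal F.L γ b₀ p₀ j / 4) → PlaqSmall (θBal F.L γ b₀ p₀ j / 4) U₁ → PlaqSmall (θBal F.L γ b₀ p₀ j / 4) V₁ → PlaqSmall (θBal F.L γ b₀ p₀ j / 4) W₂ →
      (∀ e, e ≠ B → V₁ e = U₁ e) → V₁ B = U₁ B * expPt m → (∀ e, e ≠ B' → W₂ e = V₁ e) → W₂ B' = V₁ B' * expPt m' →
      ∀ (X : ℝ → GaugeField (F.P j) 0 ↥(Matrix.specialUnitaryGroup (Fin 2) ℂ)), (∀ s e, e ≠ B' → X s e = V₁ e) → (∀ s, X s B' = V₁ B' * expPt (s • m')) →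
      ∀ s ∈ Set.Icc (0:ℝ) 1,
        Prof (X s) (fun z => (Real.log (ρ Ts (Φ (V₁, z))) - Real.log (ρ' Ts (Φ (V₁, z)))) - (Real.log (ρ Ts (Φ (U₁, z))) - Real.log (ρ' Ts (Φ (U₁, z))))) (fun a => ‖m‖ / (θBal F.L γ b₀ p₀ j / 4) * K a B) ∧
          Prof (X s) (fun z => (Real.log (ρ Ts (Φ (V₁, z))) - Real.log (ρ' Ts (Φ (V₁, z)))) + (Real.log (ρ Ts (Φ (U₁, z))) - Real.log (ρ' Ts (Φ (U₁, z))))) KS ∧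
          Prof (X s) (fun z => deriv (fun s => wNum F γ b₀ p₀ j Ts ρ ρ' Φ J t (X s) z) s / wNum F γ b₀ p₀ j Ts ρ ρ' Φ J t (X s) z) (fun a => ‖m'‖ / (θBal F.L γ b₀ p₀ j / 4) * Q₁ a B'))
    -- the law facts are the FRAME'S (✓`lawFactsV3_of_reg`): frame measurability + the knit-side `hpath` (✓`jv3Sq_of_ilawAE`'s text VERBATIM) replace ✓p826244's `hlaw`
    (hmF : ∀ (V : GaugeField (F.P j) 0 ↥(Matrix.specialUnitaryGroup (Fin 2) ℂ)), AEStronglyMeasurable (fun z => Real.log (ρ Ts (Φ (V, z))) - Real.log (ρ' Ts (Φ (V, z)))) τ)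
    (hΦm : Measurable Φ) (hJm : Measurable J) (hρm : Measurable (ρ Ts)) (hρ'm : Measurable (ρ' Ts))
    (hpath : ∀ (t : ℝ), 0 ≤ t → t ≤ 1 → ∀ (B B' : PBond (F.P j) 0) (m m' : Fin 3 → ℝ) (U₁ V₁ : GaugeField (F.P j) 0 ↥(Matrix.specialUnitaryGroup (Fin 2) ℂ)) (X : ℝ → GaugeField (F.P j) 0 ↥(Matrix.specialUnitaryGroup (Fin 2) ℂ)), ‖m‖ ≤ rc * (θBal F.L γ b₀ p₀ j / 4) → ‖m'‖ ≤ rc * (θBal F.L γ b₀ p₀ j / 4) →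
      PlaqSmall (θBal F.L γ b₀ p₀ j / 4) U₁ → PlaqSmall (θBal F.L γ b₀ p₀ j / 4) V₁ → (∀ e, e ≠ B → V₁ e = U₁ e) → V₁ B = U₁ B * expPt m → (∀ s e, e ≠ B' → X s e = V₁ e) → (∀ s, X s B' = V₁ B' * expPt (s • m')) →
      ∀ s ∈ Set.Icc (0:ℝ) 1, Integrable (fun z => wNum F γ b₀ p₀ j Ts ρ ρ' Φ J t (X s) z) τ ∧ Integrable (fun z => ((Real.log (ρ Ts (Φ (V₁, z))) - Real.log (ρ' Ts (Φ (V₁, z)))) - (Real.log (ρ Ts (Φ (U₁, z))) - Real.log (ρ' Ts (Φ (U₁, z))))) * wNum F γ b₀ p₀ j Ts ρ ρ' Φ J t (X s) z) τ ∧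
        Integrable (fun z => ((Real.log (ρ Ts (Φ (V₁, z))) - Real.log (ρ' Ts (Φ (V₁, z)))) + (Real.log (ρ Ts (Φ (U₁, z))) - Real.log (ρ' Ts (Φ (U₁, z))))) * wNum F γ b₀ p₀ j Ts ρ ρ' Φ J t (X s) z) τ ∧ Integrable (fun z => (((Real.log (ρ Ts (Φ (V₁, z))) - Real.log (ρ' Ts (Φ (V₁, z)))) - (Real.log (ρ Ts (Φ (U₁, z))) - Real.log (ρ' Ts (Φ (U₁, z))))) * ((Real.log (ρ Ts (Φ (V₁, z))) - Real.log (ρ' Ts (Φ (V₁, z)))) + (Real.log (ρ Ts (Φ (U₁, z))) - Real.log (ρ' Ts (Φ (U₁, z)))))) * wNum F γ b₀ p₀ j Ts ρ ρ' Φ J t (X s) z) τ ∧ ∫ z, wNum F γ b₀ p₀ j Ts ρ ρ' Φ J t (X s) z ∂τ ≠ 0)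
    (hM : Ncol * NG * Nrow ≤ NV3 * ((((F.L : ℝ) ^ j / γ) * θBal F.L γ b₀ p₀ j ^ 2) / (((F.L : ℝ) ^ Ts / γ) * θBal F.L γ b₀ p₀ Ts ^ 2)) * w * (w / (((F.L : ℝ) ^ Ts / γ) * θBal F.L γ b₀ p₀ Ts ^ 2)) + δV3 j * (((F.L : ℝ) ^ j / γ) * θBal F.L γ b₀ p₀ j ^ 2)) :
    (∃ kV₃ : PBond (F.P j) 0 → PBond (F.P j) 0 → ℝ, (∀ B B', 0 ≤ kV₃ B B') ∧ (∀ B, ∑ B', kV₃ B B' * Real.exp (κ * (B.src.tdist B'.src : ℝ)) ≤ NV3 * ((((F.L : ℝ) ^ j / γ) * θBal F.L γ b₀ p₀ j ^ 2) / (((F.L : ℝ) ^ Ts / γ) * θBal F.L γ b₀ p₀ Ts ^ 2)) * w * (w / (((F.L : ℝ) ^ Ts / γ) * θBal F.L γ b₀ p₀ Ts ^ 2)) + δV3 j * (((F.L : ℝ) ^ j / γ) * θBal F.L γ b₀ p₀ j ^ 2)) ∧ (∀ B', ∑ B, kV₃ B B' * Real.exp (κ * (B.src.tdist B'.src : ℝ))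 ≤ NV3 * ((((F.L : ℝ) ^ j / γ) * θBal F.L γ b₀ p₀ j ^ 2) / (((F.L : ℝ) ^ Ts / γ) * θBal F.L γ b₀ p₀ Ts ^ 2)) * w * (w / (((F.L : ℝ) ^ Ts / γ) * θBal F.L γ b₀ p₀ Ts ^ 2)) + δV3 j * (((F.L : ℝ) ^ j / γ) * θBal F.L γ b₀ p₀ j ^ 2)) ∧ ∀ t : ℝ, 0 ≤ t → t ≤ 1 → (∀ (B B' : PBond (F.P j) 0) (m m' : Fin 3 → ℝ) (U₁ V₁ W₂ : GaugeField (F.P j) 0 ↥(Matrix.specialUnitaryGroup (Fin 2) ℂ)), ‖m‖ ≤ rc * (θBal F.L γ b₀ p₀ j / 4) → ‖m'‖ ≤ rc * (θBal F.L γ b₀ p₀ j / 4) → PlaqSmall (θBal F.L γ b₀ p₀ j / 4) U₁ → PlaqSmall (θBal F.L γ b₀ p₀ j / 4) V₁ → PlaqSmall (θBal F.L γ b₀ p₀ j / 4) W₂ → (∀ e, e ≠ B → V₁ e = U₁ e) → V₁ B = U₁ B * expPt m → (∀ e, e ≠ B' → W₂ e = V₁ e) → W₂ B' = V₁ B' *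 expPt m' → ∀ (X : ℝ → GaugeField (F.P j) 0 ↥(Matrix.specialUnitaryGroup (Fin 2) ℂ)), (∀ s e, e ≠ B' → X s e = V₁ e) → (∀ s, X s B' = V₁ B' * expPt (s • m')) →
            (∃ (b bD bS bDS : Z → ℝ), Integrable b τ ∧ Integrable bD τ ∧ Integrable bS τ ∧ Integrable bDS τ ∧
              (∀ᵐ z ∂τ, LipschitzOnWith (Real.nnabs (b z)) (fun s => wNum F γ b₀ p₀ j Ts ρ ρ' Φ J t (X s) z) (Set.Ioo (-1) 2)) ∧
              (∀ᵐ z ∂τ, LipschitzOnWith (Real.nnabs (bD z)) (fun s => ((Real.log (ρ Ts (Φ (V₁, z))) - Real.log (ρ' Ts (Φ (V₁, z)))) - (Real.log (ρ Ts (Φ (U₁, z))) - Real.log (ρ' Ts (Φ (U₁, z))))) * wNum F γ b₀ p₀ j Ts ρ ρ' Φ J t (X s) z) (Set.Ioo (-1) 2)) ∧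
              (∀ᵐ z ∂τ, LipschitzOnWith (Real.nnabs (bS z)) (fun s => ((Real.log (ρ Ts (Φ (V₁, z))) - Real.log (ρ' Ts (Φ (V₁, z)))) + (Real.log (ρ Ts (Φ (U₁, z))) - Real.log (ρ' Ts (Φ (U₁, z))))) * wNum F γ b₀ p₀ j Ts ρ ρ' Φ J t (X s) z) (Set.Ioo (-1) 2)) ∧
              (∀ᵐ z ∂τ, LipschitzOnWith (Real.nnabs (bDS z)) (fun s => (((Real.log (ρ Ts (Φ (V₁, z))) - Real.log (ρ' Ts (Φ (V₁, z)))) - (Real.log (ρ Ts (Φ (U₁, z))) - Real.log (ρ' Ts (Φ (U₁, z))))) * ((Real.log (ρ Ts (Φ (V₁, z))) - Real.log (ρ' Ts (Φ (V₁, z)))) + (Real.log (ρ Ts (Φ (U₁, z))) - Real.log (ρ' Ts (Φ (U₁, z)))))) * wNum F γ b₀ p₀ j Ts ρ ρ' Φ J t (X s) z) (Set.Ioo (-1) 2))) ∧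
              (∀ᵐ s ∂(volume : Measure ℝ), s ∈ Set.Icc (0:ℝ) 1 → |(((∫ z, (((Real.log (ρ Ts (Φ (V₁, z))) - Real.log (ρ' Ts (Φ (V₁, z)))) - (Real.log (ρ Ts (Φ (U₁, z))) - Real.log (ρ' Ts (Φ (U₁, z))))) * ((Real.log (ρ Ts (Φ (V₁, z))) - Real.log (ρ' Ts (Φ (V₁, z)))) + (Real.log (ρ Ts (Φ (U₁, z))) - Real.log (ρ' Ts (Φ (U₁, z)))))) * (deriv (fun s => wNum F γ b₀ p₀ j Ts ρ ρ' Φ J t (X s) z) s / wNum F γ b₀ p₀ j Ts ρ ρ' Φ J t (X s) z) * (wNum F γ b₀ p₀ j Ts ρ ρ' Φ J t (X s) z / ∫ z', wNum F γ b₀ p₀ j Ts ρ ρ' Φ J t (X s) z' ∂τ) ∂τ)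
                  - (∫ z, (((Real.log (ρ Ts (Φ (V₁, z))) - Real.log (ρ' Ts (Φ (V₁, z)))) - (Real.log (ρ Ts (Φ (U₁, z))) - Real.log (ρ' Ts (Φ (U₁, z))))) * ((Real.log (ρ Ts (Φ (V₁, z))) - Real.log (ρ' Ts (Φ (V₁, z)))) + (Real.log (ρ Ts (Φ (U₁, z))) - Real.log (ρ' Ts (Φ (U₁, z)))))) * (wNum F γ b₀ p₀ j Ts ρ ρ' Φ J t (X s) z / ∫ z', wNum F γ b₀ p₀ j Ts ρ ρ' Φ J t (X s) z' ∂τ) ∂τ) * (∫ z, (deriv (fun s => wNum F γ b₀ p₀ j Ts ρ ρ' Φ J t (X s) z) s / wNum F γ b₀ p₀ j Ts ρ ρ' Φ J t (X s) z) * (wNum F γ b₀ p₀ j Ts ρ ρ' Φ J t (X s) z / ∫ z', wNum F γ b₀ p₀ j Ts ρ ρ' Φ J t (X s) z' ∂τ) ∂τ))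
                - (((∫ z, ((Real.log (ρ Ts (Φ (V₁, z))) - Real.log (ρ' Ts (Φ (V₁, z)))) - (Real.log (ρ Ts (Φ (U₁, z))) - Real.log (ρ' Ts (Φ (U₁, z))))) * (deriv (fun s => wNum F γ b₀ p₀ j Ts ρ ρ' Φ J t (X s) z) s / wNum F γ b₀ p₀ j Ts ρ ρ' Φ J t (X s) z) * (wNum F γ b₀ p₀ j Ts ρ ρ' Φ J t (X s) z / ∫ z', wNum F γ b₀ p₀ j Ts ρ ρ' Φ J t (X s) z' ∂τ) ∂τ)
                      - (∫ z, ((Real.log (ρ Ts (Φ (V₁, z))) - Real.log (ρ' Ts (Φ (V₁, z)))) - (Real.log (ρ Ts (Φ (U₁, z))) - Real.log (ρ' Ts (Φ (U₁, z))))) * (wNum F γ b₀ p₀ j Ts ρ ρ' Φ J t (X s) z / ∫ z', wNum F γ b₀ p₀ j Ts ρ ρ' Φ J t (X s) z' ∂τ) ∂τ) * (∫ z, (deriv (fun s => wNum F γ b₀ p₀ j Ts ρ ρ' Φ J t (X s) z) s / wNum F γ b₀ p₀ j Ts ρ ρ' Φ J t (X s) z) * (wNum F γ b₀ p₀ j Ts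 ρ ρ' Φ J t (X s) z / ∫ z', wNum F γ b₀ p₀ j Ts ρ ρ' Φ J t (X s) z' ∂τ) ∂τ))
                    * (∫ z, ((Real.log (ρ Ts (Φ (V₁, z))) - Real.log (ρ' Ts (Φ (V₁, z)))) + (Real.log (ρ Ts (Φ (U₁, z))) - Real.log (ρ' Ts (Φ (U₁, z))))) * (wNum F γ b₀ p₀ j Ts ρ ρ' Φ J t (X s) z / ∫ z', wNum F γ b₀ p₀ j Ts ρ ρ' Φ J t (X s) z' ∂τ) ∂τ)
                  + (∫ z, ((Real.log (ρ Ts (Φ (V₁, z))) - Real.log (ρ' Ts (Φ (V₁, z)))) - (Real.log (ρ Ts (Φ (U₁, z))) - Real.log (ρ' Ts (Φ (U₁, z))))) * (wNum F γ b₀ p₀ j Ts ρ ρ' Φ J t (X s) z / ∫ z', wNum F γ b₀ p₀ j Ts ρ ρ' Φ J t (X s) z' ∂τ) ∂τ)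
                    * ((∫ z, ((Real.log (ρ Ts (Φ (V₁, z))) - Real.log (ρ' Ts (Φ (V₁, z)))) + (Real.log (ρ Ts (Φ (U₁, z))) - Real.log (ρ' Ts (Φ (U₁, z))))) * (deriv (fun s => wNum F γ b₀ p₀ j Ts ρ ρ' Φ J t (X s) z) s / wNum F γ b₀ p₀ j Ts ρ ρ' Φ J t (X s) z) * (wNum F γ b₀ p₀ j Ts ρ ρ' Φ J t (X s) z / ∫ z', wNum F γ b₀ p₀ j Ts ρ ρ' Φ J t (X s) z' ∂τ) ∂τ)
                      - (∫ z, ((Real.log (ρ Ts (Φ (V₁, z))) - Real.log (ρ' Ts (Φ (V₁, z)))) + (Real.log (ρ Ts (Φ (U₁, z))) - Real.log (ρ' Ts (Φ (U₁, z))))) * (wNum F γ b₀ p₀ j Ts ρ ρ' Φ J t (X s) z / ∫ z', wNum F γ b₀ p₀ j Ts ρ ρ' Φ J t (X s) z' ∂τ) ∂τ) * (∫ z, (deriv (fun s => wNum F γ b₀ p₀ j Ts ρ ρ' Φ J t (X s) z) s / wNum F γ b₀ p₀ j Ts ρ ρ' Φ J t (X s) z) * (wNum F γ b₀ p₀ j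 Ts ρ ρ' Φ J t (X s) z / ∫ z', wNum F γ b₀ p₀ j Ts ρ ρ' Φ J t (X s) z' ∂τ) ∂τ))))| ≤ kV₃ B B' * (‖m‖ / (θBal F.L γ b₀ p₀ j / 4)) * (‖m'‖ / (θBal F.L γ b₀ p₀ j / 4))))) := by
  have hreg := ilawRegV3_of_beta_of_incr F γ b₀ p₀ j Ts hjTs ρ ρ' hρc hρ'c hρpos hθ hχc hχsupp rA Bρ Bρ' hrA hβ hβ' τ Φ J CJ hJle hcont hθj rc hrc hguard
      KJ hδ k hk0 hK hkμ hwin hrad hθmax0 hθle h24 hPJ hPincr hSJ hSincr c hc Db hDb0 DP hDb hdisp hroom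
  obtain ⟨kV, h0, hrow, hcol, hker⟩ := kerV3_organ F γ b₀ p₀ j Ts ρ ρ' τ Φ J rc κ
    (NV3 * ((((F.L : ℝ) ^ j / γ) * θBal F.L γ b₀ p₀ j ^ 2) / (((F.L : ℝ) ^ Ts / γ) * θBal F.L γ b₀ p₀ Ts ^ 2)) * w * (w / (((F.L : ℝ) ^ Ts / γ) * θBal F.L γ b₀ p₀ Ts ^ 2)) + δV3 j * (((F.L : ℝ) ^ j / γ) * θBal F.L γ b₀ p₀ j ^ 2)) hθj Prof 𝒢₃ KS ωf NG hG0 hKS0 hωf hNG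
    hGrow hGcol hωfsymm hCum K Q₁ ωX Ncol Nrow hK0 hQ0 hωX hNcol hNrow hKcol hKrow hQrow hQcol htri htdsymm hProfF
    (lawFactsV3_of_reg F γ b₀ p₀ j Ts ρ ρ' τ Φ J rc hmF hΦm hJm hρm hρ'm hχc hpath hreg) hM
  exact ⟨kV, h0, hrow, hcol, fun t ht0 ht1 B B' m m' U₁ V₁ W₂ hm hm' hU hV hW hVU hVB hWU hWB X hoff hon =>
    ⟨hreg t ht0 ht1 B B' m m' U₁ V₁ W₂ hm hm' hU hV hW hVU hVB hWU hWB X hoff hon, hker t ht0 ht1 B B' m m' U₁ V₁ W₂ hm hm' hU hV hW hVU hVB hWU hWB X hoff hon⟩⟩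

end Summit.QuantumFields.YangMills.Theorems.OrganTangentILawPathBlocksKnitFrame

end
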